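import Literature.Computability.Complexity.NondeterministicKannanQuantifiers
import Literature.Computability.Complexity.TM2AnyList
import Literature.Computability.Complexity.TM2Disjunction
import Literature.Computability.Complexity.TM2IterateBound
import Literature.Computability.Complexity.MapFstMachine
import Literature.Computability.Complexity.ExpPadding
import Literature.Computability.Complexity.MajorityEnumeration
import Literature.Computability.Complexity.StringEquality
import Literature.Computability.Complexity.KannanLanguage
import HarnessLib

/-!
# Exhaustive-search deciders for bounded quantifiers; `nlang ∈ DTIME(2^{2^{O(n)}})`

The machine half of the named fact `NKannan.nlang_mem_DTIME_exp_exp`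
(`NondeterministicKannan.lean`: the least truth table hard for nondeterministic circuit
descriptions, `NKannan.nlang`, is computable in deterministic time `2^{2^{c n}}`), continuing
`NondeterministicKannanQuantifiers.lean`, where that language is written as five nested bounded
quantifiers `BEX k β A = {w | ∃ y ∈ {0,1}^{β |fstP^[k] w|}, ⟨w, y⟩ ∈ A}` / `BALL` over
polynomial-time matrices (`NKannan.nlang_eq_BEX_TOP`). Main result:

* **`NKannan.nlang_mem_DTIME_exp_exp_holds : nlang_mem_DTIME_exp_exp`** — the discharge, whence
  (with `NKannan.nlang_not_mem_NP`) an unconditional language in `DTIME(2^{2^{O(n)}}) ∖ NP` over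
  Mathlib's `TM2` model, and `Literature.Barriers.PneNP.MCSPKarpHardness_holds` (Murray–Williams).

On the way we prove, once, the folklore "a bounded quantifier over `b` bits costs a factor
`2^{O(b)}` in deterministic time" (Arora–Barak 2009, §2.1: "enumerate all possible
certificates and check each", the proof of `NP ⊆ EXP`; §1.3–1.4: composition of machines,
clocked loops) in a form that nests:

* the currency `NKannan.DecIn k A t` — some machine decides `A` within `t n N` steps on every
  word `u` of length `N` whose `k`-fold first projection `fstP^[k] u` (the original input `x`)
  has length `n` (a per-word `DecidesInTime` bound; two parameters because the quantifier ranges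
  depend on `n`, not on `N`) — with its closure under complement (same time, `complMachine`),
  union and intersection (`Turing.TM2ComputableAux.or_outputsWithin`, additive time) and the
  embedding of `P` (`DecIn.of_mem_P`);
* `NKannan.UnaryProducer β` — some machine writes `0^{β |x|}` on input `x` in time
  `2^{O(|x|)}` — with the four producers needed (`β = n`, `2^n`, `wit n = 2^{n/2}`,
  `budget n + 1 = 2^{n-1} + 1`: the exponential ones by the padding machine of
  `ExpPadding.lean`, `exists_timeComputable_expPad`, between two small transducers);
* **`NKannan.DecIn.bex`**: `DecIn (k+1) A t → UnaryProducer β → ∃ c, DecIn k (BEX k β A)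
  (bexCost c β t)` with `bexCost c β t n N = 2^{c (N + β n + 1)} · (t n (2N + 2 + β n) + 1)`,
  and dually `NKannan.DecIn.ball`;
* the growth class `NKannan.Tame` of bounds `t n N ≤ 2^{2^{O(n)}}` for `N ≤ 2^{O(n)}`, closed
  under the cost of Boolean combinations and of `bexCost` (bookkeeping predicates `Bnd`, `Bnd2`),
  the bundle `NKannan.DecT k A` (a tame decider at level `k`), and `DecIn.mem_DTIME`: at the top
  level a tame decider is a `DTIME(2^{2^{c n}})` algorithm; the assembly then follows the
  definition of `nlang` (`L0_decT`, `NACC_decT`, `NEQV_decT`, `EXY_decT`, `HARD_decT`,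
  `MINL_decT`, `TOP_decT`, `nlang_decT`).

The decider of `BEX k β A` is assembled from the tree's machine toolkit only (no machine is
programmed): a *lister* `M₁` — the sequential composite (`comp_outputsWithin`) of `FP` stages
(pairing bricks), the producer of `0^b` run on the first component (`mapFstAux`), the padding
machine producing an exponential unary clock, the transducer `ticksT` turning it into the input
format of the clocked loop `TM2Iter.iterAux` (`TM2IterateBound.lean`) of the `FP` round
`⟨⟨w, y⟩, acc⟩ ↦ ⟨⟨w, y + 1⟩, acc ++ ⟨⟨w, y⟩, ε⟩⟩` (binary successor `CoinEnum.incFn` on the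
fixed-width numerals `natBits b i` of `MajorityEnumeration.lean`), the projection onto the
accumulator and the transducer `transT` writing it as a `none`-separated list over
`Option Bool` — followed by the list-disjunction machine `any_outputsWithin` (`TM2AnyList.lean`)
running the decider of `A` on every entry `⟨w, y⟩`. The clock is deliberately generous
(`2^{|⟨⟨w, 0^b⟩, ε⟩|} ≥ 2^b` rounds, the numerals cycling modulo `2^b`), which keeps the clock
transducer trivial; all costs are `2^{O(N + b)}` (predicate `NKannan.Bnd`). No attempt at
efficiency is made: only the shape `2^{2^{O(n)}}` of the final bound matters.

Mathlib has no time-bounded machine constructions beyond the identity (searched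
`Computability/TuringMachine`, `TMComputable`); everything used is the tree's `FinTM2` toolkit.

## References

* S. Arora, B. Barak, *Computational Complexity: A Modern Approach*, CUP 2009, §1.3–1.4
  (machine composition, clocked simulation), §2.1 (exhaustive search over certificates,
  `NP ⊆ EXP`), §2.6.1 (complement). [AroraBarak2009]
* R. Kannan, *Circuit-size lower bounds and non-reducibility to sparse sets*, Inform. and
  Control 55 (1982) 40–56, Lemma 3 and its proof, p. 46 (the exhaustive search this serves).
  [Kannan1982]
-/

namespace Literature.Computability.Complexity

namespace NKannan

open _root_.Computability Turing Function Polynomial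

/-! ### Small transducers -/

section FSTs

/-- `ticksT`: the leading `1`s become clock ticks `none`; the first `0` is dropped and the rest is
copied as data `some c` — from `1^R 0 s` to the input format `noneᴿ ++ s.map some` of the loop
machine `TM2Iter.iterAux`. State `false` = inside the unary prefix. [folklore] -/
def ticksT : FST Bool Bool (Option Bool) where
  init := false
  step := fun s c => if s then (true, [some c]) else if c then (false, [none]) else (true, [])
  front := fun _ => []
  keep := fun _ => true

/-- The transition of `ticksT`. [folklore] -/
@[simp] theorem ticksT_step (s c : Bool) :
    ticksT.step s c = (if s then (true, [some c]) else if c then (false, [none]) else (true, [])) := rfl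

/-- `ticksT` outputs the emitted body (empty front, body kept). [folklore] -/
theorem ticksT_eval_eq (l : List Bool) : ticksT.eval l = (ticksT.run false l).2 := by
  simp [FST.eval, ticksT]

/-- In the copying state `ticksT` emits `some c` per symbol. [folklore] -/
theorem ticksT_run_true (s : List Bool) : (ticksT.run true s).2 = s.map some := by
  induction s with
  | nil => rfl
  | cons c s ih => simp [FST.run_cons, ih]

/-- On the unary prefix `ticksT` emits one tick per `1`. [folklore] -/
theorem ticksT_run_ones (R : ℕ) :
    ticksT.run false (List.replicate R true) = (false, List.replicate R none) := by
  induction R with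
  | zero => rfl
  | succ R ih => simp [List.replicate_succ, FST.run_cons, ih]

/-- `ticksT` maps `1^R 0 s` to `noneᴿ ++ s.map some`. [folklore] -/
theorem ticksT_eval (R : ℕ) (s : List Bool) :
    ticksT.eval (List.replicate R true ++ false :: s) = List.replicate R none ++ s.map some := by
  rw [ticksT_eval_eq, FST.run_append, ticksT_run_ones]
  simp [FST.run_cons, ticksT_run_true]

/-- `stripT`: `some c ↦ c`, `none ↦ ε` (the data of a mixed word). [folklore] -/
def stripT : FST Unit (Option Bool) Bool where
  init := ()
  step := fun _ o => ((), o.toList)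
  front := fun _ => []
  keep := fun _ => true

/-- The transition of `stripT`. [folklore] -/
@[simp] theorem stripT_step (u : Unit) (o : Option Bool) : stripT.step u o = ((), o.toList) := rfl

/-- `stripT` outputs the emitted body. [folklore] -/
theorem stripT_eval_eq (l : List (Option Bool)) : stripT.eval l = (stripT.run () l).2 := by
  simp [FST.eval, stripT]

/-- `stripT` recovers `e` from `e.map some`. [folklore] -/
theorem stripT_eval_map_some (e : List Bool) : stripT.eval (e.map some) = e := by
  rw [stripT_eval_eq]
  induction e with
  | nil => rfl
  | cons c e ih => simp [FST.run_cons, ih]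

/-- `transT`: reads its input two symbols at a time; an equal pair `cc` is the data symbol
`some c`, an unequal pair (the separator `01` of `boolPair`) is the list separator `none`. State
`some c` = first symbol `c` of the current pair read. [folklore] -/
def transT : FST (Option Bool) Bool (Option Bool) where
  init := none
  step := fun s c =>
    match s with
    | none => (some c, [])
    | some c' => (none, [if c' = c then some c else none])
  front := fun _ => []
  keep := fun _ => true

/-- The transition of `transT` on the first symbol of a pair. [folklore] -/
@[simp] theorem transT_step_none (c : Bool) : transT.step none c = (some c, []) := rfl

/-- The transition of `transT` on the second symbol of a pair. [folklore] -/
@[simp] theorem transT_step_some (c' c : Bool) :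
    transT.step (some c') c = (none, [if c' = c then some c else none]) := rfl

/-- `transT` outputs the emitted body. [folklore] -/
theorem transT_eval_eq (l : List Bool) : transT.eval l = (transT.run none l).2 := by
  simp [FST.eval, transT]

/-- `transT` on a doubled block `dup e` emits `e.map some`. [folklore] -/
theorem transT_run_dup (e rest : List Bool) :
    transT.run none (StrCopy.dup e ++ rest) =
      ((transT.run none rest).1, e.map some ++ (transT.run none rest).2) := by
  induction e with
  | nil => simp [StrCopy.dup]
  | cons c e ih =>
    simp only [StrCopy.dup, List.flatMap_cons] at ih ⊢
    simp [FST.run_cons, ih]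

/-- `transT` on a one-entry code `boolPair e []` emits `e.map some ++ [none]`. [folklore] -/
theorem transT_run_entry (e rest : List Bool) :
    transT.run none (boolPair e [] ++ rest) =
      ((transT.run none rest).1, e.map some ++ none :: (transT.run none rest).2) := by
  rw [StrCopy.boolPair_eq_dup, List.append_assoc, transT_run_dup]
  simp [FST.run_cons]

/-- `transT` turns the concatenation of the one-entry codes `⟨e, ε⟩ = boolPair e []` into the
`none`-terminated list of the words `e.map some`. [folklore] -/
theorem transT_eval_flatMap (es : List (List Bool)) :
    transT.eval (es.flatMap fun e => boolPair e []) = es.flatMap fun e => e.map some ++ [none] := by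
  rw [transT_eval_eq]
  induction es with
  | nil => rfl
  | cons e es ih =>
    rw [List.flatMap_cons, transT_run_entry, ih, List.flatMap_cons]
    simp

/-- `flipTakeT`: emits `0` for every leading `1` and stops emitting at the first `0`:
`1^R 0 s ↦ 0^R`. State `true` = still emitting. [folklore] -/
def flipTakeT : FST Bool Bool Bool where
  init := true
  step := fun s c => if s && c then (true, [false]) else (false, [])
  front := fun _ => []
  keep := fun _ => true

/-- The transition of `flipTakeT`. [folklore] -/
@[simp] theorem flipTakeT_step (s c : Bool) :
    flipTakeT.step s c = (if s && c then (true, [false]) else (false, [])) := rfl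

/-- `flipTakeT` outputs the emitted body. [folklore] -/
theorem flipTakeT_eval_eq (l : List Bool) : flipTakeT.eval l = (flipTakeT.run true l).2 := by
  simp [FST.eval, flipTakeT]

/-- Once stopped, `flipTakeT` emits nothing. [folklore] -/
theorem flipTakeT_run_false (s : List Bool) : (flipTakeT.run false s).2 = [] := by
  induction s with
  | nil => rfl
  | cons c s ih => simp [FST.run_cons, ih]

/-- On `1^R`, `flipTakeT` emits `0^R` and keeps emitting. [folklore] -/
theorem flipTakeT_run_ones (R : ℕ) :
    flipTakeT.run true (List.replicate R true) = (true, List.replicate R false) := by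
  induction R with
  | zero => rfl
  | succ R ih => simp [List.replicate_succ, FST.run_cons, ih]

/-- `flipTakeT` maps `1^R 0 s` to `0^R`. [folklore] -/
theorem flipTakeT_eval (R : ℕ) (s : List Bool) :
    flipTakeT.eval (List.replicate R true ++ false :: s) = List.replicate R false := by
  rw [flipTakeT_eval_eq, FST.run_append, flipTakeT_run_ones]
  simp [FST.run_cons, flipTakeT_run_false]

/-- `flipTakePlusT`: as `flipTakeT`, emitting one more `0` at the first `0`:
`1^R 0 s ↦ 0^{R+1}`. [folklore] -/
def flipTakePlusT : FST Bool Bool Bool where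
  init := true
  step := fun s c => if s then (if c then (true, [false]) else (false, [false])) else (false, [])
  front := fun _ => []
  keep := fun _ => true

/-- The transition of `flipTakePlusT`. [folklore] -/
@[simp] theorem flipTakePlusT_step (s c : Bool) :
    flipTakePlusT.step s c =
      (if s then (if c then (true, [false]) else (false, [false])) else (false, [])) := rfl

/-- `flipTakePlusT` outputs the emitted body. [folklore] -/
theorem flipTakePlusT_eval_eq (l : List Bool) :
    flipTakePlusT.eval l = (flipTakePlusT.run true l).2 := by
  simp [FST.eval, flipTakePlusT]

/-- Once stopped, `flipTakePlusT` emits nothing. [folklore] -/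
theorem flipTakePlusT_run_false (s : List Bool) : (flipTakePlusT.run false s).2 = [] := by
  induction s with
  | nil => rfl
  | cons c s ih => simp [FST.run_cons, ih]

/-- On `1^R`, `flipTakePlusT` emits `0^R` and keeps emitting. [folklore] -/
theorem flipTakePlusT_run_ones (R : ℕ) :
    flipTakePlusT.run true (List.replicate R true) = (true, List.replicate R false) := by
  induction R with
  | zero => rfl
  | succ R ih => simp [List.replicate_succ, FST.run_cons, ih]

/-- `flipTakePlusT` maps `1^R 0 s` to `0^{R+1}`. [folklore] -/
theorem flipTakePlusT_eval (R : ℕ) (s : List Bool) :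
    flipTakePlusT.eval (List.replicate R true ++ false :: s) = List.replicate (R + 1) false := by
  rw [flipTakePlusT_eval_eq, FST.run_append, flipTakePlusT_run_ones]
  simp [FST.run_cons, flipTakePlusT_run_false, List.replicate_succ']

/-- `halfT`: keeps every second symbol, so `|halfT.eval x| = |x| / 2`. State `true` = emit the
next symbol. [folklore] -/
def halfT : FST Bool Bool Bool where
  init := false
  step := fun s c => if s then (false, [c]) else (true, [])
  front := fun _ => []
  keep := fun _ => true

/-- The transition of `halfT`. [folklore] -/
@[simp] theorem halfT_step (s c : Bool) :
    halfT.step s c = (if s then (false, [c]) else (true, [])) := rfl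

/-- `halfT` outputs the emitted body. [folklore] -/
theorem halfT_eval_eq (l : List Bool) : halfT.eval l = (halfT.run false l).2 := by
  simp [FST.eval, halfT]

/-- The emitted lengths of `halfT` from both states. [folklore] -/
theorem length_halfT_run (x : List Bool) :
    (halfT.run false x).2.length = x.length / 2 ∧
      (halfT.run true x).2.length = (x.length + 1) / 2 := by
  induction x with
  | nil => simp
  | cons c x ih =>
    obtain ⟨h0, h1⟩ := ih
    constructor <;> simp [FST.run_cons, h0, h1]
    omega

/-- `|halfT.eval x| = |x| / 2`. [folklore] -/
theorem length_halfT_eval (x : List Bool) : (halfT.eval x).length = x.length / 2 := by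
  rw [halfT_eval_eq]
  exact (length_halfT_run x).1

/-- `dropT`: drops the first symbol, so `|dropT.eval x| = |x| - 1`. State `true` = first symbol
already dropped. [folklore] -/
def dropT : FST Bool Bool Bool where
  init := false
  step := fun s c => if s then (true, [c]) else (true, [])
  front := fun _ => []
  keep := fun _ => true

/-- The transition of `dropT`. [folklore] -/
@[simp] theorem dropT_step (s c : Bool) :
    dropT.step s c = (if s then (true, [c]) else (true, [])) := rfl

/-- `dropT` outputs the emitted body. [folklore] -/
theorem dropT_eval_eq (l : List Bool) : dropT.eval l = (dropT.run false l).2 := by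
  simp [FST.eval, dropT]

/-- After the first symbol `dropT` copies. [folklore] -/
theorem dropT_run_true (x : List Bool) : (dropT.run true x).2 = x := by
  induction x with
  | nil => rfl
  | cons c x ih => simp [FST.run_cons, ih]

/-- `|dropT.eval x| = |x| - 1`. [folklore] -/
theorem length_dropT_eval (x : List Bool) : (dropT.eval x).length = x.length - 1 := by
  rw [dropT_eval_eq]
  cases x with
  | nil => rfl
  | cons c x => simp [FST.run_cons, dropT_run_true]

/-- A transducer as a bundled machine with its linear time bound (`FST.timeComputable_eval`,
unbundled). [folklore] -/
theorem _root_.Literature.Computability.Complexity.FST.exists_outputsWithin {σ Γ₀ Γ₁ : Type}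
    [Fintype σ] [Fintype Γ₀] [Fintype Γ₁] (T : FST σ Γ₀ Γ₁) :
    ∃ M : TM2ComputableAux Γ₀ Γ₁, ∀ l : List Γ₀,
      M.OutputsWithin l (T.eval l) ((T.maxEmit + 1) * l.length + 3) :=
  T.timeComputable_eval

end FSTs

/-! ### Exponential bookkeeping: quantities `≤ 2^{O(S)}` -/

section Bnd

variable {ι : Type}

/-- `Bnd S Q`: the quantity `Q i` is at most `2^{a · S i}` for a constant `a` (used with
`S = N + b + 1 ≥ 1`). [folklore] -/
def Bnd (S : ι → ℕ) (Q : ι → ℕ) : Prop := ∃ a : ℕ, ∀ i, Q i ≤ 2 ^ (a * S i)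

variable {S : ι → ℕ} (hS : ∀ i, 1 ≤ S i)

/-- A quantity below a bounded one is bounded. [folklore] -/
theorem Bnd.mono {Q Q' : ι → ℕ} (h : Bnd S Q) (hle : ∀ i, Q' i ≤ Q i) : Bnd S Q' := by
  obtain ⟨a, ha⟩ := h
  exact ⟨a, fun i => (hle i).trans (ha i)⟩

include hS in
/-- Affine quantities `≤ K · S + K` are bounded (`x ≤ 2^x`). [folklore] -/
theorem Bnd.of_le_lin (K : ℕ) {Q : ι → ℕ} (h : ∀ i, Q i ≤ K * S i + K) : Bnd S Q := by
  refine ⟨2 * K, fun i => (h i).trans ?_⟩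
  have h1 : K * S i + K ≤ 2 * K * S i := by have := hS i; nlinarith
  exact (Nat.lt_two_pow_self).le.trans (Nat.pow_le_pow_right (by norm_num) h1)

include hS in
/-- Constants are bounded (`K ≤ 2^{K S}` for `S ≥ 1`). [folklore] -/
theorem Bnd.const (K : ℕ) : Bnd S (fun _ => K) :=
  Bnd.of_le_lin hS K fun _ => Nat.le_add_left _ _

include hS in
/-- `2^{affine}` is bounded. [folklore] -/
theorem Bnd.two_pow (K : ℕ) {Q : ι → ℕ} (h : ∀ i, Q i ≤ K * S i + K) :
    Bnd S (fun i => 2 ^ Q i) := by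
  refine ⟨K + K, fun i => Nat.pow_le_pow_right (by norm_num) ((h i).trans ?_)⟩
  have := hS i; nlinarith

include hS in
/-- Sums of bounded quantities are bounded. [folklore] -/
theorem Bnd.add {Q Q' : ι → ℕ} (h : Bnd S Q) (h' : Bnd S Q') : Bnd S (fun i => Q i + Q' i) := by
  obtain ⟨a, ha⟩ := h
  obtain ⟨a', ha'⟩ := h'
  refine ⟨a + a' + 1, fun i => ?_⟩
  have h1 : 2 ^ (a * S i) ≤ 2 ^ ((a + a') * S i) :=
    Nat.pow_le_pow_right (by norm_num) (Nat.mul_le_mul_right _ (Nat.le_add_right _ _))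
  have h2 : 2 ^ (a' * S i) ≤ 2 ^ ((a + a') * S i) :=
    Nat.pow_le_pow_right (by norm_num) (Nat.mul_le_mul_right _ (Nat.le_add_left _ _))
  have h3 : 2 ^ ((a + a') * S i) * 2 ≤ 2 ^ ((a + a' + 1) * S i) := by
    rw [← pow_succ]
    exact Nat.pow_le_pow_right (by norm_num) (by have := hS i; nlinarith)
  have := ha i; have := ha' i
  show Q i + Q' i ≤ _
  omega

/-- Products of bounded quantities are bounded (exponents add). [folklore] -/
theorem Bnd.mul {Q Q' : ι → ℕ} (h : Bnd S Q) (h' : Bnd S Q') : Bnd S (fun i => Q i * Q' i) := by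
  obtain ⟨a, ha⟩ := h
  obtain ⟨a', ha'⟩ := h'
  refine ⟨a + a', fun i => ?_⟩
  rw [add_mul, pow_add]
  exact Nat.mul_le_mul (ha i) (ha' i)

/-- Powers of a bounded quantity are bounded. [folklore] -/
theorem Bnd.pow {Q : ι → ℕ} (h : Bnd S Q) (d : ℕ) : Bnd S (fun i => Q i ^ d) := by
  obtain ⟨a, ha⟩ := h
  refine ⟨d * a, fun i => ?_⟩
  rw [mul_assoc, mul_comm d, pow_mul]
  exact Nat.pow_le_pow_left (ha i) d

include hS in
/-- A polynomial of a bounded quantity is bounded. [folklore] -/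
theorem Bnd.poly (p : Polynomial ℕ) {Q : ι → ℕ} (h : Bnd S Q) : Bnd S (fun i => p.eval (Q i)) := by
  obtain ⟨c, d, hcd⟩ := exists_eval_le_mul_pow_add p
  have h1 : Bnd S (fun i => c * Q i ^ d + c) :=
    Bnd.add hS (Bnd.mul (Bnd.const hS c) (h.pow d)) (Bnd.const hS c)
  exact h1.mono fun i => hcd _

/-- The final inequality of `DecIn.bex`: lister, `R` entries of cost `tA + overhead`, `+ 2`.
[folklore] -/
theorem bex_arith {c₁ c₂ S m₁ R tA s l : ℕ} (hS : 1 ≤ S) (hm₁ : m₁ ≤ 2 ^ (c₁ * S))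
    (hR : R ≤ 2 ^ (6 * S)) (hX : R * (s + l + 3) + 2 ≤ 2 ^ (c₂ * S)) :
    m₁ + R * (tA + s + l + 3) + 2 ≤ 2 ^ ((c₁ + c₂ + 7) * S) * (tA + 1) := by
  have h1 : R ≤ 2 ^ ((c₁ + c₂ + 7) * S) :=
    hR.trans (Nat.pow_le_pow_right (by norm_num) (Nat.mul_le_mul_right _ (by omega)))
  have h2 : 2 ^ (c₁ * S) + 2 ^ (c₂ * S) ≤ 2 ^ ((c₁ + c₂ + 7) * S) := by
    have a : 2 ^ (c₁ * S) ≤ 2 ^ ((c₁ + c₂) * S) :=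
      Nat.pow_le_pow_right (by norm_num) (Nat.mul_le_mul_right _ (by omega))
    have b : 2 ^ (c₂ * S) ≤ 2 ^ ((c₁ + c₂) * S) :=
      Nat.pow_le_pow_right (by norm_num) (Nat.mul_le_mul_right _ (by omega))
    have c : 2 ^ ((c₁ + c₂) * S) * 2 ≤ 2 ^ ((c₁ + c₂ + 7) * S) := by
      rw [← pow_succ]; exact Nat.pow_le_pow_right (by norm_num) (by nlinarith)
    omega
  have e : m₁ + R * (tA + s + l + 3) + 2 = R * tA + (m₁ + (R * (s + l + 3) + 2)) := by ring
  rw [e, Nat.mul_add (2 ^ ((c₁ + c₂ + 7) * S)) tA 1, Nat.mul_one]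
  exact Nat.add_le_add (Nat.mul_le_mul_right _ h1) (by omega)

end Bnd

/-! ### The currency: deciders timed by core length and word length -/

section DecIn

/-- `DecIn k A t`: some machine decides `A ⊆ {0,1}*` within `t n N` steps on every word `u` of
length `N` with `|fstP^[k] u| = n` (the `k`-fold first projection is the original input of the
nested quantifiers). A per-word `DecidesInTime` bound. [folklore] -/
def DecIn (k : ℕ) (A : Language Bool) (t : ℕ → ℕ → ℕ) : Prop :=
  ∃ M : TM2ComputableAux Bool Bool,
    DecidesInTime id A (fun u => t (fstP^[k] u).length u.length) M

variable {k : ℕ} {A A' : Language Bool} {t t' : ℕ → ℕ → ℕ}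

/-- Monotonicity in the time bound. [folklore] -/
theorem DecIn.mono (h : DecIn k A t) (hle : ∀ n N, t n N ≤ t' n N) : DecIn k A t' := by
  obtain ⟨M, hM⟩ := h
  exact ⟨M, fun u => (hM u).mono (hle _ _)⟩

/-- Closure under complement, same time (`complMachine`). [cite: AroraBarak2009, §2.6.1] -/
theorem DecIn.compl (h : DecIn k A t) : DecIn k Aᶜ t := by
  obtain ⟨M, hM⟩ := h
  exact ⟨complMachine M, hM.compl⟩

/-- A decider of the complement gives a decider, same time. [folklore] -/
theorem DecIn.of_compl (h : DecIn k Aᶜ t) : DecIn k A t := by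
  simpa using h.compl

/-- The indicator of a union is the disjunction of the indicators. [folklore] -/
theorem boolIndicator_sup (A A' : Language Bool) (u : List Bool) :
    Set.boolIndicator (A ⊔ A') u = (Set.boolIndicator A u || Set.boolIndicator A' u) := by
  rw [Bool.eq_iff_iff]
  simp only [Bool.or_eq_true]
  rw [← Set.mem_iff_boolIndicator, ← Set.mem_iff_boolIndicator, ← Set.mem_iff_boolIndicator]
  exact Iff.rfl

/-- Closure under union, additive time (`or_outputsWithin`: both deciders run on the same
input). [cite: AroraBarak2009, §1.3] -/
theorem DecIn.sup (h : DecIn k A t) (h' : DecIn k A' t') :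
    DecIn k (A ⊔ A') (fun n N => t n N + t' n N + 2 * N + 4) := by
  obtain ⟨M, hM⟩ := h
  obtain ⟨M', hM'⟩ := h'
  refine ⟨M.orMachine M', fun u => ?_⟩
  have H := TM2ComputableAux.or_outputsWithin M M' (l := u) (b₁ := Set.boolIndicator A u)
    (b₂ := Set.boolIndicator A' u) (hM u) (hM' u)
  have e : encodeBool (Set.boolIndicator (A ⊔ A') u) =
      [Set.boolIndicator A u || Set.boolIndicator A' u] := by
    rw [boolIndicator_sup]; rfl
  change (M.orMachine M').OutputsWithin u (encodeBool (Set.boolIndicator (A ⊔ A') u)) _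
  rw [e]
  exact H

/-- Closure under intersection (De Morgan). [cite: AroraBarak2009, §1.3] -/
theorem DecIn.inf (h : DecIn k A t) (h' : DecIn k A' t') :
    DecIn k (A ⊓ A') (fun n N => t n N + t' n N + 2 * N + 4) := by
  have H := (h.compl.sup h'.compl).compl
  rwa [compl_sup, compl_compl, compl_compl] at H

/-- Languages in `P` are decided in polynomial time in the word length, at every level `k`.
[cite: AroraBarak2009, Def. 1.13] -/
theorem DecIn.of_mem_P (hA : A ∈ Classes.P) (k : ℕ) :
    ∃ c d : ℕ, DecIn k A (fun _ N => c * N ^ d + c) := by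
  obtain ⟨d, hd⟩ := Set.mem_iUnion.1 hA
  obtain ⟨c, M, hM⟩ := hd
  exact ⟨c, d, M, hM⟩

end DecIn

/-! ### Unary producers -/

section Producers

/-- `UnaryProducer β`: some machine writes `0^{β |x|}` on input `x` within `2^{c (|x| + 1)}`
steps. [folklore] -/
def UnaryProducer (β : ℕ → ℕ) : Prop :=
  ∃ (c : ℕ) (U : TM2ComputableAux Bool Bool), ∀ x : List Bool,
    U.OutputsWithin x (List.replicate (β x.length) false) (2 ^ (c * (x.length + 1)))

/-- Packaging a producer from any machine with a `Bnd`-bounded time. [folklore] -/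
theorem unaryProducer_of_bnd {β : ℕ → ℕ} (U : TM2ComputableAux Bool Bool) {T : List Bool → ℕ}
    (hU : ∀ x, U.OutputsWithin x (List.replicate (β x.length) false) (T x))
    (hT : Bnd (fun x : List Bool => x.length + 1) T) : UnaryProducer β := by
  obtain ⟨a, ha⟩ := hT
  exact ⟨a, U, fun x => (hU x).mono (ha x)⟩

/-- The producer of `0^{|x|}` (`Kannan.zerosFn ∈ FP`). [folklore] -/
theorem unaryProducer_id : UnaryProducer fun n => n := by
  obtain ⟨p, U, hU⟩ := Kannan.zerosFn_mem_FP
  have hS : ∀ x : List Bool, 1 ≤ x.length + 1 := fun x => Nat.succ_pos _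
  refine unaryProducer_of_bnd U (T := fun x => p.eval x.length) (fun x => ?_)
    (Bnd.poly hS p (Bnd.of_le_lin hS 1 fun x => by omega))
  have := hU x
  rwa [Kannan.zerosFn_apply] at this

/-- Producers through the padding machine: if `G` is a transducer with `|G x| = ℓ |x|`,
`ℓ n ≤ n`, and `H` a transducer with `H (1^R 0 s) = 0^{φ R}`, then
`x ↦ 0^{φ (2^{ℓ |x|})}` is produced in time `2^{O(|x|)}` (`H ∘ expPad 1 ∘ G`). [folklore] -/
theorem unaryProducer_of_expPad {σ σ' : Type} [Fintype σ] [Fintype σ'] (G : FST σ Bool Bool)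
    (H : FST σ' Bool Bool) (ℓ φ : ℕ → ℕ) (hG : ∀ x, (G.eval x).length = ℓ x.length)
    (hℓ : ∀ n, ℓ n ≤ n)
    (hH : ∀ R s, H.eval (List.replicate R true ++ false :: s) = List.replicate (φ R) false) :
    UnaryProducer fun n => φ (2 ^ ℓ n) := by
  obtain ⟨MG, hMG⟩ := G.exists_outputsWithin
  obtain ⟨MH, hMH⟩ := H.exists_outputsWithin
  obtain ⟨C, ME, hME⟩ := exists_timeComputable_expPad (k := 1) le_rfl
  have hS : ∀ x : List Bool, 1 ≤ x.length + 1 := fun x => Nat.succ_pos _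
  refine unaryProducer_of_bnd ((MG.comp ME).comp MH)
    (T := fun x => ((H.maxEmit + 1) * (2 ^ ℓ x.length + ℓ x.length + 1) + 3) +
      ((C * 2 ^ ℓ x.length + C) + ((G.maxEmit + 1) * x.length + 3))) (fun x => ?_) ?_
  · have h1 := hMG x
    have h2 : ME.OutputsWithin (G.eval x) (expPad 1 (G.eval x)) (C * 2 ^ ℓ x.length + C) := by
      have := hME (G.eval x); simpa [hG] using this
    have h3 : MH.OutputsWithin (expPad 1 (G.eval x)) (List.replicate (φ (2 ^ ℓ x.length)) false)
        ((H.maxEmit + 1) * (2 ^ ℓ x.length + ℓ x.length + 1) + 3) := by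
      have := hMH (expPad 1 (G.eval x))
      have eH : H.eval (expPad 1 (G.eval x)) = List.replicate (φ (2 ^ ℓ x.length)) false := by
        rw [expPad, hG, pow_one, hH]
      rwa [eH, length_expPad, hG, pow_one] at this
    exact TM2ComputableAux.comp_outputsWithin _ _ (TM2ComputableAux.comp_outputsWithin _ _ h1 h2) h3
  · have hl : Bnd (fun x : List Bool => x.length + 1) fun x => 2 ^ ℓ x.length :=
      Bnd.two_pow hS 1 fun x => by have := hℓ x.length; omega
    have hn : Bnd (fun x : List Bool => x.length + 1) fun x => ℓ x.length :=
      Bnd.of_le_lin hS 1 fun x => by have := hℓ x.length; omega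
    have bc : ∀ K, Bnd (fun x : List Bool => x.length + 1) fun _ => K := fun K => Bnd.const hS K
    exact Bnd.add hS (Bnd.add hS (Bnd.mul (bc _) (Bnd.add hS (Bnd.add hS hl hn) (bc 1))) (bc 3))
      (Bnd.add hS (Bnd.add hS (Bnd.mul (bc C) hl) (bc C))
        (Bnd.add hS (Bnd.mul (bc _) (Bnd.of_le_lin hS 1 fun x => by omega)) (bc 3)))

/-- The identity transduction (one state, copy). [folklore] -/
def idT : FST Unit Bool Bool where
  init := ()
  step := fun _ c => ((), [c])
  front := fun _ => []
  keep := fun _ => true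

/-- The transition of `idT`. [folklore] -/
@[simp] theorem idT_step (u : Unit) (c : Bool) : idT.step u c = ((), [c]) := rfl

/-- `idT` outputs the emitted body. [folklore] -/
theorem idT_eval_eq (l : List Bool) : idT.eval l = (idT.run () l).2 := by
  simp [FST.eval, idT]

/-- `idT` copies its input. [folklore] -/
theorem idT_run (x : List Bool) : (idT.run () x).2 = x := by
  induction x with
  | nil => rfl
  | cons c x ih => simp [FST.run_cons, ih]

/-- `idT` computes the identity. [folklore] -/
theorem idT_eval (x : List Bool) : idT.eval x = x := by
  rw [idT_eval_eq, idT_run]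

/-- The producer of `0^{2^{|x|}}`. [folklore] -/
theorem unaryProducer_two_pow : UnaryProducer fun n => 2 ^ n := by
  have := unaryProducer_of_expPad idT flipTakeT (fun n => n) (fun R => R)
    (fun x => by rw [idT_eval]) (fun _ => le_rfl) flipTakeT_eval
  simpa using this

/-- The producer of `0^{wit |x|}`, `wit n = 2^{n/2}`. [folklore] -/
theorem unaryProducer_wit : UnaryProducer wit := by
  have := unaryProducer_of_expPad halfT flipTakeT (fun n => n / 2) (fun R => R)
    length_halfT_eval (fun n => Nat.div_le_self n 2) flipTakeT_eval
  show UnaryProducer fun n => wit n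
  simpa [wit] using this

/-- The producer of `0^{budget |x| + 1}`, `budget n = 2^{n-1}`. [folklore] -/
theorem unaryProducer_budget_succ : UnaryProducer fun n => budget n + 1 := by
  have := unaryProducer_of_expPad dropT flipTakePlusT (fun n => n - 1) (fun R => R + 1)
    length_dropT_eval (fun n => Nat.sub_le n 1) flipTakePlusT_eval
  simpa [budget] using this

end Producers

/-! ### The round function of the lister and its orbit -/

section Round

/-- Binary successor on fixed-width numerals, cyclically. [folklore] -/
theorem incFn_natBits (b i : ℕ) : CoinEnum.incFn (natBits b i) = natBits b (i + 1) := by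
  rw [CoinEnum.incFn_apply]
  cases b with
  | zero => rfl
  | succ b =>
    have hB : 1 < 2 ^ (b + 1) := Nat.one_lt_two_pow (Nat.succ_ne_zero b)
    have hper : ∀ j, natBits (b + 1) j = natBits (b + 1) (j % 2 ^ (b + 1)) := fun j => by
      have h := CoinEnum.natBits_bitsToNat (natBits (b + 1) j)
      rw [length_natBits, CoinEnum.bitsToNat_natBits_mod] at h
      exact h.symm
    have hmod : (i + 1) % 2 ^ (b + 1) = (i % 2 ^ (b + 1) + 1) % 2 ^ (b + 1) := by
      rw [Nat.add_mod, Nat.mod_eq_of_lt hB]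
    rw [hper i, hper (i + 1), hmod]
    by_cases h : i % 2 ^ (b + 1) + 1 < 2 ^ (b + 1)
    · rw [CoinEnum.ib_natBits_of_lt h, Nat.mod_eq_of_lt h]
    · have he : i % 2 ^ (b + 1) = 2 ^ (b + 1) - 1 := by
        have := Nat.mod_lt i (Nat.two_pow_pos (b + 1)); omega
      rw [he, Nat.sub_add_cancel hB.le, Nat.mod_self, CoinEnum.ib_natBits_last]

/-- The round of the lister: `⟨⟨w, y⟩, acc⟩ ↦ ⟨⟨w, y + 1⟩, acc ++ ⟨⟨w, y⟩, ε⟩⟩`, a string function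
in `FP` (pairing bricks, `CoinEnum.incFn`). [folklore] -/
noncomputable def roundFn : List Bool → List Bool :=
  fanoutFn (fanoutFn (fstP ∘ fstP) (CoinEnum.incFn ∘ sndP ∘ fstP))
    (fun z => sndP z ++ fanoutFn fstP (fun _ => []) z)

/-- The round function is in `FP`. [folklore] -/
theorem roundFn_mem_FP : roundFn ∈ FP :=
  fanoutFn_mem_FP (fanoutFn_mem_FP (comp_mem_FP fstP_mem_FP fstP_mem_FP)
    (comp_mem_FP CoinEnum.incFn_mem_FP (comp_mem_FP sndP_mem_FP fstP_mem_FP)))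
    (append_mem_FP sndP_mem_FP (fanoutFn_mem_FP fstP_mem_FP (const_mem_FP _)))

/-- The round function on a well-formed state. [folklore] -/
theorem roundFn_apply (w y acc : List Bool) :
    roundFn (boolPair (boolPair w y) acc) =
      boolPair (boolPair w (CoinEnum.incFn y)) (acc ++ boolPair (boolPair w y) []) := by
  simp [roundFn]

/-- The accumulator after `i` rounds: the codes `⟨⟨w, natBits b j⟩, ε⟩`, `j < i`. [folklore] -/
def accW (w : List Bool) (b i : ℕ) : List Bool :=
  (List.range i).flatMap fun j => boolPair (boolPair w (natBits b j)) []

/-- The state after `i` rounds. [folklore] -/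
def stW (w : List Bool) (b i : ℕ) : List Bool :=
  boolPair (boolPair w (natBits b i)) (accW w b i)

/-- One more round appends one entry code. [folklore] -/
theorem accW_succ (w : List Bool) (b i : ℕ) :
    accW w b (i + 1) = accW w b i ++ boolPair (boolPair w (natBits b i)) [] := by
  simp [accW, List.range_succ, List.flatMap_append]

/-- One round advances the state. [folklore] -/
theorem roundFn_stW (w : List Bool) (b i : ℕ) : roundFn (stW w b i) = stW w b (i + 1) := by
  rw [stW, roundFn_apply, incFn_natBits, stW, accW_succ]

/-- **Orbit of the round function.** [folklore] -/
theorem iterate_roundFn_stW (w : List Bool) (b i : ℕ) : roundFn^[i] (stW w b 0) = stW w b i := by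
  induction i with
  | zero => rfl
  | succ i ih => rw [iterate_succ_apply', ih, roundFn_stW]

/-- Length of the accumulator after `i` rounds. [folklore] -/
theorem length_accW (w : List Bool) (b i : ℕ) :
    (accW w b i).length = i * (2 * (2 * w.length + 2 + b) + 2) := by
  induction i with
  | zero => simp [accW]
  | succ i ih =>
    rw [accW_succ, List.length_append, ih, length_boolPair, length_boolPair, length_natBits,
      List.length_nil]
    ring

/-- Length of the state after `i` rounds. [folklore] -/
theorem length_stW (w : List Bool) (b i : ℕ) :
    (stW w b i).length = (i + 1) * (2 * (2 * w.length + 2 + b) + 2) := by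
  rw [stW, length_boolPair, length_boolPair, length_accW, length_natBits]
  ring

/-- The accumulator, transcoded, is the `none`-separated list of the entries `⟨w, natBits b j⟩`.
[folklore] -/
theorem transT_eval_accW (w : List Bool) (b i : ℕ) :
    transT.eval (accW w b i) =
      (List.range i).flatMap fun j => (boolPair w (natBits b j)).map some ++ [none] := by
  have h := transT_eval_flatMap ((List.range i).map fun j => boolPair w (natBits b j))
  rw [List.flatMap_map, List.flatMap_map] at h
  exact h

/-- **Coverage.** With at least `2^b` rounds the entries `natBits b j`, `j < R`, are all the
strings of length `b`, so the disjunction over the list is the bounded existential quantifier.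
[folklore] -/
theorem any_range_eq_boolIndicator_BEX {k : ℕ} {β : ℕ → ℕ} {A : Language Bool} (w : List Bool)
    {R : ℕ} (hR : 2 ^ β (fstP^[k] w).length ≤ R) :
    ((List.range R).any fun j =>
        Set.boolIndicator A (boolPair w (natBits (β (fstP^[k] w).length) j))) =
      Set.boolIndicator (BEX k β A) w := by
  rw [Bool.eq_iff_iff, List.any_eq_true, ← Set.mem_iff_boolIndicator]
  change _ ↔ w ∈ BEX k β A
  rw [mem_BEX]
  constructor
  · rintro ⟨j, -, hj⟩
    rw [← Set.mem_iff_boolIndicator] at hj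
    exact ⟨_, length_natBits _ _, hj⟩
  · rintro ⟨y, hy, hyA⟩
    have h1 : bitsToNat y < 2 ^ β (fstP^[k] w).length := by rw [← hy]; exact bitsToNat_lt y
    have h2 : natBits (β (fstP^[k] w).length) (bitsToNat y) = y := by
      rw [← hy]; exact CoinEnum.natBits_bitsToNat y
    refine ⟨bitsToNat y, List.mem_range.2 (lt_of_lt_of_le h1 hR), ?_⟩
    rw [← Set.mem_iff_boolIndicator, h2]
    exact hyA

end Round

/-! ### The lister and the decider of `BEX` -/

section Lister

/-- `|fstP^[k] u| ≤ |u|`. [folklore] -/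
theorem length_iterate_fstP_le (k : ℕ) (u : List Bool) : (fstP^[k] u).length ≤ u.length := by
  induction k generalizing u with
  | zero => exact le_rfl
  | succ k ih =>
    rw [iterate_succ_apply]
    exact (ih _).trans (length_boolUnpair_fst_le u)

/-- Iterated first projections are in `FP`. [folklore] -/
theorem iterate_fstP_mem_FP (k : ℕ) : fstP^[k] ∈ FP := by
  induction k with
  | zero => rw [iterate_zero]; exact OracleCompose.id_mem_FP
  | succ k ih => rw [iterate_succ']; exact comp_mem_FP fstP_mem_FP ih

/-- The number of rounds of the lister on a word of length `N` with range `b`: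
`2^{|⟨⟨w, 0^b⟩, ε⟩|} = 2^{4N + 2b + 6}`. [folklore] -/
def rounds (N b : ℕ) : ℕ := 2 ^ (4 * N + 2 * b + 6)

/-- The clock is generous: at least `2^b` rounds. [folklore] -/
theorem two_pow_le_rounds (N b : ℕ) : 2 ^ b ≤ rounds N b :=
  Nat.pow_le_pow_right (by norm_num) (by omega)

/-- Unbundling `f ∈ FP`. [folklore] -/
theorem exists_outputsWithin_of_mem_FP {f : List Bool → List Bool} (hf : f ∈ FP) :
    ∃ (p : Polynomial ℕ) (M : TM2ComputableAux Bool Bool),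
      ∀ z, M.OutputsWithin z (f z) (p.eval z.length) := by
  obtain ⟨p, M, hM⟩ := hf
  exact ⟨p, M, hM⟩

/-- **The lister.** For a unary producer of `β` there is a machine which, on any word `w` with
core `x = fstP^[k] w` of length `n` and `b = β n`, writes the `none`-separated list of the words
`⟨w, natBits b j⟩`, `j < rounds |w| b`, within `2^{c (|w| + b + 1)}` steps. [folklore] -/
theorem exists_lister (k : ℕ) {β : ℕ → ℕ} (hβ : UnaryProducer β) :
    ∃ (c : ℕ) (M₁ : TM2ComputableAux Bool (Option Bool)), ∀ w : List Bool,
      M₁.OutputsWithin w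
        ((List.range (rounds w.length (β (fstP^[k] w).length))).flatMap fun j =>
          (boolPair w (natBits (β (fstP^[k] w).length) j)).map some ++ [none])
        (2 ^ (c * (w.length + β (fstP^[k] w).length + 1))) := by
  classical
  obtain ⟨cU, U, hU⟩ := hβ
  -- stage machines
  obtain ⟨p₁, M1, hM1⟩ := exists_outputsWithin_of_mem_FP
    (fanoutFn_mem_FP (iterate_fstP_mem_FP k) OracleCompose.id_mem_FP)
  obtain ⟨p₃, M3, hM3⟩ := exists_outputsWithin_of_mem_FP
    (fanoutFn_mem_FP (fanoutFn_mem_FP sndP_mem_FP fstP_mem_FP) (const_mem_FP []))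
  obtain ⟨C, M4, hM4⟩ := exists_timeComputable_expPad (k := 1) le_rfl
  obtain ⟨M5, hM5⟩ := ticksT.exists_outputsWithin
  obtain ⟨pF, MF, hMF⟩ := exists_outputsWithin_of_mem_FP roundFn_mem_FP
  obtain ⟨p₇, M7, hM7⟩ := exists_outputsWithin_of_mem_FP sndP_mem_FP
  obtain ⟨M8, hM8⟩ := transT.exists_outputsWithin
  have hF : ∀ a : List Bool, MF.OutputsWithin (id a) (id (roundFn a)) (pF.eval (id a).length) :=
    fun a => hMF a
  let M₁ : TM2ComputableAux Bool (Option Bool) :=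
    ((((((M1.comp (mapFstAux U)).comp M3).comp M4).comp M5).comp (TM2Iter.iterAux MF)).comp M7).comp M8
  -- the size parameter and the quantities along the pipeline
  let S : List Bool → ℕ := fun w => w.length + β (fstP^[k] w).length + 1
  have hS : ∀ w, 1 ≤ S w := fun w => Nat.succ_pos _
  let n : List Bool → ℕ := fun w => (fstP^[k] w).length
  let b : List Bool → ℕ := fun w => β (n w)
  let E : List Bool → ℕ := fun w => 2 * (2 * w.length + 2 + b w) + 2
  let R : List Bool → ℕ := fun w => rounds w.length (b w)
  let B : List Bool → ℕ := fun w => (R w + 1) * E w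
  -- the total time, last stage first (`comp_outputsWithin` adds `m₂ + m₁`)
  let T : List Bool → ℕ := fun w =>
    ((transT.maxEmit + 1) * (R w * E w) + 3) +
    (p₇.eval ((R w + 1) * E w) +
    ((2 * E w + R w + 4 + R w * (2 * B w + 3 + pF.eval (B w))) +
    (((ticksT.maxEmit + 1) * (R w + E w + 1) + 3) +
    ((C * 2 ^ E w + C) +
    (p₃.eval (2 * b w + 2 + w.length) +
    ((2 ^ (cU * (n w + 1)) + 3 * b w + 2 * (2 * n w + 2 + w.length) + 6) +
    p₁.eval w.length))))))
  have hn : ∀ w, n w ≤ w.length := fun w => length_iterate_fstP_le k w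
  have hE : ∀ w, E w = 4 * w.length + 2 * b w + 6 := fun w => by simp only [E]; ring
  -- the bound `T ≤ 2^{O(S)}`
  have hT : Bnd S T := by
    have bc : ∀ K, Bnd S fun _ => K := fun K => Bnd.const hS K
    have bN : Bnd S fun w => w.length := Bnd.of_le_lin hS 1 fun w => by simp only [S]; omega
    have bn : Bnd S n := bN.mono hn
    have bb : Bnd S b := Bnd.of_le_lin hS 1 fun w => by simp only [S, b, n]; omega
    have bE : Bnd S E := Bnd.of_le_lin hS 6 fun w => by rw [hE]; simp only [S, b, n]; omega
    have bR : Bnd S R := by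
      simpa only [R, rounds] using
        Bnd.two_pow hS 6 (Q := fun w => 4 * w.length + 2 * b w + 6)
          (fun w => by simp only [S, b, n]; omega)
    have b2E : Bnd S fun w => 2 ^ E w :=
      Bnd.two_pow hS 6 fun w => by rw [hE]; simp only [S, b, n]; omega
    have bU : Bnd S fun w => 2 ^ (cU * (n w + 1)) :=
      Bnd.two_pow hS cU (Q := fun w => cU * (n w + 1)) fun w => by
        have := hn w; simp only [S]; nlinarith
    have bB : Bnd S B := Bnd.mul (Bnd.add hS bR (bc 1)) bE
    refine Bnd.add hS (Bnd.add hS (Bnd.mul (bc _) (Bnd.mul bR bE)) (bc 3)) ?_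
    refine Bnd.add hS (Bnd.poly hS p₇ bB) ?_
    refine Bnd.add hS (Bnd.add hS (Bnd.add hS (Bnd.add hS (Bnd.mul (bc 2) bE) bR) (bc 4))
      (Bnd.mul bR (Bnd.add hS (Bnd.add hS (Bnd.mul (bc 2) bB) (bc 3)) (Bnd.poly hS pF bB)))) ?_
    refine Bnd.add hS (Bnd.add hS (Bnd.mul (bc _) (Bnd.add hS (Bnd.add hS bR bE) (bc 1))) (bc 3)) ?_
    refine Bnd.add hS (Bnd.add hS (Bnd.mul (bc C) b2E) (bc C)) ?_
    refine Bnd.add hS (Bnd.poly hS p₃ (Bnd.add hS (Bnd.add hS (Bnd.mul (bc 2) bb) (bc 2)) bN)) ?_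
    refine Bnd.add hS (Bnd.add hS (Bnd.add hS (Bnd.add hS bU (Bnd.mul (bc 3) bb))
      (Bnd.mul (bc 2) (Bnd.add hS (Bnd.add hS (Bnd.mul (bc 2) bn) (bc 2)) bN))) (bc 6)) ?_
    exact Bnd.poly hS p₁ bN
  obtain ⟨c, hc⟩ := hT
  refine ⟨c, M₁, fun w => ?_⟩
  refine TM2ComputableAux.OutputsWithin.mono ?_ (hc w)
  -- the run, stage by stage
  have e0 : natBits (b w) 0 = List.replicate (b w) false := CoinEnum.natBits_zero _
  have hE0 : (stW w (b w) 0).length = E w := by simp only [length_stW, E]; ring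
  -- 1. `w ↦ ⟨x, w⟩`
  have h1 : M1.OutputsWithin w (boolPair (fstP^[k] w) w) (p₁.eval w.length) := by
    have := hM1 w; simpa using this
  -- 2. `⟨x, w⟩ ↦ ⟨0^b, w⟩`
  have h2 : (mapFstAux U).OutputsWithin (boolPair (fstP^[k] w) w)
      (boolPair (List.replicate (b w) false) w)
      (2 ^ (cU * (n w + 1)) + 3 * b w + 2 * (2 * n w + 2 + w.length) + 6) := by
    have hUx := hU (fstP^[k] w)
    have H := outputsWithin_mapFstAux U (z := boolPair (fstP^[k] w) w)
      (out := List.replicate (b w) false) (m := 2 ^ (cU * (n w + 1)))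
      (by rw [boolUnpair_boolPair]; exact hUx)
    rw [readRest_boolPair] at H
    refine H.mono (le_of_eq ?_)
    simp only [List.length_replicate, length_boolPair, n, b]
  -- 3. `⟨0^b, w⟩ ↦ ⟨⟨w, 0^b⟩, ε⟩ = stW w b 0`
  have h3 : M3.OutputsWithin (boolPair (List.replicate (b w) false) w) (stW w (b w) 0)
      (p₃.eval (2 * b w + 2 + w.length)) := by
    have := hM3 (boolPair (List.replicate (b w) false) w)
    simpa [stW, accW, e0] using this
  -- 4. the clock: `1^R 0 (stW w b 0)`
  have h4 : M4.OutputsWithin (stW w (b w) 0)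
      (List.replicate (R w) true ++ false :: stW w (b w) 0) (C * 2 ^ E w + C) := by
    have := hM4 (stW w (b w) 0)
    simp only [id_eq, pow_one, hE0] at this
    have eX : List.replicate (R w) true ++ false :: stW w (b w) 0 = expPad 1 (stW w (b w) 0) := by
      simp only [expPad, pow_one, hE0, R, rounds, hE]
    rw [eX]
    exact this
  -- 5. ticks and data
  have hl5 : (List.replicate (R w) true ++ false :: stW w (b w) 0).length = R w + E w + 1 := by
    simp only [List.length_append, List.length_replicate, List.length_cons, hE0]; omega
  have h5 : M5.OutputsWithin (List.replicate (R w) true ++ false :: stW w (b w) 0)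
      (List.replicate (R w) none ++ (stW w (b w) 0).map some)
      ((ticksT.maxEmit + 1) * (R w + E w + 1) + 3) := by
    have := hM5 (List.replicate (R w) true ++ false :: stW w (b w) 0)
    rwa [ticksT_eval, hl5] at this
  -- 6. the loop
  have h6 : (TM2Iter.iterAux MF).OutputsWithin
      (List.replicate (R w) none ++ (stW w (b w) 0).map some)
      (stW w (b w) (R w)) (2 * E w + R w + 4 + R w * (2 * B w + 3 + pF.eval (B w))) := by
    have H := TM2Iter.iterAux_outputsWithin_of_le (ea := id) (F := roundFn) MF pF hF
      (stW w (b w) 0) (R w) (B w) (fun i hi => by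
        simp only [id_eq, iterate_roundFn_stW, length_stW, B, E]
        exact Nat.mul_le_mul_right _ (by omega))
    simp only [id_eq, iterate_roundFn_stW, hE0] at H
    exact H
  -- 7. projection onto the accumulator
  have h7 : M7.OutputsWithin (stW w (b w) (R w)) (accW w (b w) (R w)) (p₇.eval ((R w + 1) * E w)) := by
    have := hM7 (stW w (b w) (R w))
    simp only [length_stW] at this
    simpa [stW, E] using this
  -- 8. transcoding
  have h8 : M8.OutputsWithin (accW w (b w) (R w))
      ((List.range (R w)).flatMap fun j => (boolPair w (natBits (b w) j)).map some ++ [none])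
      ((transT.maxEmit + 1) * (R w * E w) + 3) := by
    have := hM8 (accW w (b w) (R w))
    rw [transT_eval_accW, length_accW] at this
    simpa [E] using this
  exact TM2ComputableAux.comp_outputsWithin _ _ (TM2ComputableAux.comp_outputsWithin _ _
    (TM2ComputableAux.comp_outputsWithin _ _ (TM2ComputableAux.comp_outputsWithin _ _
    (TM2ComputableAux.comp_outputsWithin _ _ (TM2ComputableAux.comp_outputsWithin _ _
    (TM2ComputableAux.comp_outputsWithin _ _ h1 h2) h3) h4) h5) h6) h7) h8

/-- The cost of a bounded existential quantifier: `2^{c (N + β n + 1)} · (t n (2N + 2 + β n) + 1)`.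
[folklore] -/
def bexCost (c : ℕ) (β : ℕ → ℕ) (t : ℕ → ℕ → ℕ) (n N : ℕ) : ℕ :=
  2 ^ (c * (N + β n + 1)) * (t n (2 * N + 2 + β n) + 1)

/-- **Exhaustive search for a bounded existential quantifier.** If `A` is decided within
`t n N'` steps on words one level up and `0^{β n}` is producible in time `2^{O(n)}`, then
`BEX k β A = {w | ∃ y ∈ {0,1}^{β n}, ⟨w, y⟩ ∈ A}` (`n = |fstP^[k] w|`) is decided within
`2^{c (N + β n + 1)} · (t n (2N + 2 + β n) + 1)` steps on words of length `N`: list all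
candidates `⟨w, y⟩` and run the decider of `A` on each (`any_outputsWithin`).
[cite: AroraBarak2009, §2.1 (exhaustive search over all certificates) and §1.3–1.4] -/
theorem DecIn.bex {k : ℕ} {β : ℕ → ℕ} {A : Language Bool} {t : ℕ → ℕ → ℕ}
    (hA : DecIn (k + 1) A t) (hβ : UnaryProducer β) : ∃ c, DecIn k (BEX k β A) (bexCost c β t) := by
  classical
  obtain ⟨c₁, M₁, hM₁⟩ := exists_lister k hβ
  obtain ⟨MA, hMA⟩ := hA
  obtain ⟨Ms, hMs⟩ := stripT.exists_outputsWithin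
  let M₂ : TM2ComputableAux (Option Bool) Bool := Ms.comp MA
  let S : List Bool → ℕ := fun w => w.length + β (fstP^[k] w).length + 1
  have hS : ∀ w, 1 ≤ S w := fun w => Nat.succ_pos _
  let L : List Bool → ℕ := fun w => 2 * w.length + 2 + β (fstP^[k] w).length
  let R : List Bool → ℕ := fun w => rounds w.length (β (fstP^[k] w).length)
  -- pure overhead of the disjunction stage: `R · (strip + 2L + 3) + 2`
  let P : List Bool → ℕ := fun w => R w * (((stripT.maxEmit + 1) * L w + 3) + 2 * L w + 3) + 2
  have hP : Bnd S P := by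
    have bc : ∀ K, Bnd S fun _ => K := fun K => Bnd.const hS K
    have bN : Bnd S fun w => w.length := Bnd.of_le_lin hS 1 fun w => by simp only [S]; omega
    have bb : Bnd S fun w => β (fstP^[k] w).length :=
      Bnd.of_le_lin hS 1 fun w => by simp only [S]; omega
    have bL : Bnd S L := Bnd.add hS (Bnd.add hS (Bnd.mul (bc 2) bN) (bc 2)) bb
    have bR : Bnd S R := by
      simpa only [R, rounds] using
        Bnd.two_pow hS 6 (Q := fun w => 4 * w.length + 2 * β (fstP^[k] w).length + 6)
          (fun w => by simp only [S]; omega)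
    exact Bnd.add hS (Bnd.mul bR (Bnd.add hS (Bnd.add hS (Bnd.add hS (Bnd.mul (bc _) bL)
      (bc 3)) (Bnd.mul (bc 2) bL)) (bc 3))) (bc 2)
  obtain ⟨c₂, hc₂⟩ := hP
  have bR' : ∀ w, R w ≤ 2 ^ (6 * S w) := fun w =>
    Nat.pow_le_pow_right (by norm_num) (by simp only [S]; omega)
  refine ⟨c₁ + c₂ + 7, M₁.anyMachine M₂ none, fun w => ?_⟩
  show (M₁.anyMachine M₂ none).OutputsWithin w (encodeBool (Set.boolIndicator (BEX k β A) w))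
    (bexCost (c₁ + c₂ + 7) β t (fstP^[k] w).length w.length)
  -- the entries and the decider on them
  have hw : ∀ j : ℕ, (none : Option Bool) ∉
      (boolPair w (natBits (β (fstP^[k] w).length) j)).map some := by simp
  have h₂ : ∀ j : ℕ, M₂.OutputsWithin ((boolPair w (natBits (β (fstP^[k] w).length) j)).map some)
      [Set.boolIndicator A (boolPair w (natBits (β (fstP^[k] w).length) j))]
      (t (fstP^[k] w).length (2 * w.length + 2 + β (fstP^[k] w).length) +
        ((stripT.maxEmit + 1) * (2 * w.length + 2 + β (fstP^[k] w).length) + 3)) := by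
    intro j
    have hs := hMs ((boolPair w (natBits (β (fstP^[k] w).length) j)).map some)
    rw [stripT_eval_map_some, List.length_map, length_boolPair, length_natBits] at hs
    have ha := hMA (boolPair w (natBits (β (fstP^[k] w).length) j))
    simp only [id_eq, iterate_fstP_boolPair, length_boolPair, length_natBits] at ha
    exact TM2ComputableAux.comp_outputsWithin _ _ hs ha
  have H := TM2ComputableAux.any_outputsWithin M₁ M₂ (sep := none) hw (hM₁ w) h₂
  have e := any_range_eq_boolIndicator_BEX (A := A) w
    (two_pow_le_rounds w.length (β (fstP^[k] w).length))
  rw [e] at H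
  refine H.mono ?_
  simp only [List.length_map, length_boolPair, length_natBits, List.map_const', List.length_range,
    List.sum_replicate, smul_eq_mul, bexCost]
  exact bex_arith (hS w) le_rfl (bR' w) (hc₂ w)

/-- **Exhaustive search for a bounded universal quantifier** (`BALL = ¬ BEX ¬`, complements
being free). [cite: AroraBarak2009, §2.1 and §1.3–1.4] -/
theorem DecIn.ball {k : ℕ} {β : ℕ → ℕ} {A : Language Bool} {t : ℕ → ℕ → ℕ}
    (hA : DecIn (k + 1) A t) (hβ : UnaryProducer β) : ∃ c, DecIn k (BALL k β A) (bexCost c β t) := by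
  obtain ⟨c, hc⟩ := hA.compl.bex hβ
  refine ⟨c, ?_⟩
  rw [BALL_eq_compl_BEX_compl]
  exact hc.compl

end Lister

/-! ### Double-exponential bookkeeping and the assembly of `nlang ∈ DTIME(2^{2^{O(n)}})` -/

section Tame

variable {ι : Type} {S : ι → ℕ} (hS : ∀ i, 1 ≤ S i)

/-- `Bnd2 S Q`: the quantity `Q i` is at most `2^{2^{a · S i}}` for a constant `a`. [folklore] -/
def Bnd2 (S : ι → ℕ) (Q : ι → ℕ) : Prop := ∃ a : ℕ, ∀ i, Q i ≤ 2 ^ (2 ^ (a * S i))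

/-- Single-exponential quantities are double-exponentially bounded. [folklore] -/
theorem Bnd2.of_bnd {Q : ι → ℕ} (h : Bnd S Q) : Bnd2 S Q := by
  obtain ⟨a, ha⟩ := h
  exact ⟨a, fun i => (ha i).trans (Nat.pow_le_pow_right (by norm_num) (Nat.lt_two_pow_self).le)⟩

/-- `2^Q` is double-exponentially bounded for `Q` single-exponentially bounded. [folklore] -/
theorem Bnd2.two_pow {Q : ι → ℕ} (h : Bnd S Q) : Bnd2 S (fun i => 2 ^ Q i) := by
  obtain ⟨a, ha⟩ := h
  exact ⟨a, fun i => Nat.pow_le_pow_right (by norm_num) (ha i)⟩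

include hS in
/-- Sums. [folklore] -/
theorem Bnd2.add {Q Q' : ι → ℕ} (h : Bnd2 S Q) (h' : Bnd2 S Q') : Bnd2 S (fun i => Q i + Q' i) := by
  obtain ⟨a, ha⟩ := h
  obtain ⟨a', ha'⟩ := h'
  refine ⟨a + a' + 1, fun i => ?_⟩
  have h1 : 2 ^ (2 ^ (a * S i)) ≤ 2 ^ (2 ^ ((a + a') * S i)) :=
    Nat.pow_le_pow_right (by norm_num) (Nat.pow_le_pow_right (by norm_num)
      (Nat.mul_le_mul_right _ (Nat.le_add_right _ _)))
  have h2 : 2 ^ (2 ^ (a' * S i)) ≤ 2 ^ (2 ^ ((a + a') * S i)) :=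
    Nat.pow_le_pow_right (by norm_num) (Nat.pow_le_pow_right (by norm_num)
      (Nat.mul_le_mul_right _ (Nat.le_add_left _ _)))
  have h3 : 2 ^ (2 ^ ((a + a') * S i)) * 2 ≤ 2 ^ (2 ^ ((a + a' + 1) * S i)) := by
    rw [← pow_succ]
    refine Nat.pow_le_pow_right (by norm_num) ?_
    have h4 : 2 ^ ((a + a') * S i) * 2 ≤ 2 ^ ((a + a' + 1) * S i) := by
      rw [← pow_succ]
      exact Nat.pow_le_pow_right (by norm_num) (by have := hS i; nlinarith)
    have : 1 ≤ 2 ^ ((a + a') * S i) := Nat.one_le_two_pow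
    omega
  have := ha i; have := ha' i
  show Q i + Q' i ≤ _
  omega

include hS in
/-- Products. [folklore] -/
theorem Bnd2.mul {Q Q' : ι → ℕ} (h : Bnd2 S Q) (h' : Bnd2 S Q') : Bnd2 S (fun i => Q i * Q' i) := by
  obtain ⟨a, ha⟩ := h
  obtain ⟨a', ha'⟩ := h'
  refine ⟨a + a' + 1, fun i => ?_⟩
  have h1 : 2 ^ (a * S i) ≤ 2 ^ ((a + a') * S i) :=
    Nat.pow_le_pow_right (by norm_num) (Nat.mul_le_mul_right _ (Nat.le_add_right _ _))
  have h2 : 2 ^ (a' * S i) ≤ 2 ^ ((a + a') * S i) :=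
    Nat.pow_le_pow_right (by norm_num) (Nat.mul_le_mul_right _ (Nat.le_add_left _ _))
  have h3 : 2 ^ ((a + a') * S i) * 2 ≤ 2 ^ ((a + a' + 1) * S i) := by
    rw [← pow_succ]
    exact Nat.pow_le_pow_right (by norm_num) (by have := hS i; nlinarith)
  show Q i * Q' i ≤ _
  calc Q i * Q' i ≤ 2 ^ (2 ^ (a * S i)) * 2 ^ (2 ^ (a' * S i)) := Nat.mul_le_mul (ha i) (ha' i)
    _ = 2 ^ (2 ^ (a * S i) + 2 ^ (a' * S i)) := by rw [← pow_add]
    _ ≤ 2 ^ (2 ^ ((a + a' + 1) * S i)) := Nat.pow_le_pow_right (by norm_num) (by omega)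

/-- `Tame t`: on words of length `N ≤ 2^{d (n+1)}` the bound `t n N` is at most `2^{2^{a (n+1)}}`,
for every `d` and a suitable `a` — the growth class of all the bounds of the assembly. [folklore] -/
def Tame (t : ℕ → ℕ → ℕ) : Prop :=
  ∀ d : ℕ, ∃ a : ℕ, ∀ n N : ℕ, N ≤ 2 ^ (d * (n + 1)) → t n N ≤ 2 ^ (2 ^ (a * (n + 1)))

/-- Composition: a tame bound at a single-exponentially bounded length is double-exponentially
bounded. [folklore] -/
theorem Bnd2.comp_tame {t : ℕ → ℕ → ℕ} (ht : Tame t) {nf Nf : ι → ℕ} (hN : Bnd S Nf)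
    (hn : ∀ i, S i = nf i + 1) : Bnd2 S (fun i => t (nf i) (Nf i)) := by
  obtain ⟨a, ha⟩ := hN
  obtain ⟨a', ha'⟩ := ht a
  refine ⟨a', fun i => ?_⟩
  have := ha' (nf i) (Nf i) (by rw [← hn]; exact ha i)
  rwa [← hn] at this

/-- The index type of the tameness proofs: pairs `(n, N)` with `N ≤ 2^{d (n+1)}`. [folklore] -/
def TIdx (d : ℕ) : Type := {p : ℕ × ℕ // p.2 ≤ 2 ^ (d * (p.1 + 1))}

/-- From a `Bnd2` bound over all admissible pairs to tameness at `d`. [folklore] -/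
theorem tame_of_bnd2 {t : ℕ → ℕ → ℕ}
    (h : ∀ d, Bnd2 (fun i : TIdx d => i.1.1 + 1) (fun i => t i.1.1 i.1.2)) : Tame t := by
  intro d
  obtain ⟨a, ha⟩ := h d
  exact ⟨a, fun n N hN => ha ⟨(n, N), hN⟩⟩

/-- The size parameter `n + 1` is positive. [folklore] -/
theorem TIdx.one_le (d : ℕ) : ∀ i : TIdx d, 1 ≤ i.1.1 + 1 := fun _ => Nat.succ_pos _

/-- The word length is single-exponentially bounded on admissible pairs. [folklore] -/
theorem TIdx.bnd_N (d : ℕ) : Bnd (fun i : TIdx d => i.1.1 + 1) (fun i => i.1.2) := ⟨d, fun i => i.2⟩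

/-- Polynomial bounds are tame. [folklore] -/
theorem Tame.poly (c d₀ : ℕ) : Tame (fun _ N => c * N ^ d₀ + c) := by
  refine tame_of_bnd2 fun d => Bnd2.of_bnd ?_
  have hS := TIdx.one_le d
  exact Bnd.add hS (Bnd.mul (Bnd.const hS c) ((TIdx.bnd_N d).pow d₀)) (Bnd.const hS c)

/-- The cost of a Boolean combination is tame. [folklore] -/
theorem Tame.supCost {t t' : ℕ → ℕ → ℕ} (ht : Tame t) (ht' : Tame t') :
    Tame (fun n N => t n N + t' n N + 2 * N + 4) := by
  refine tame_of_bnd2 fun d => ?_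
  have hS := TIdx.one_le d
  exact Bnd2.add hS (Bnd2.add hS (Bnd2.add hS
    (Bnd2.comp_tame ht (TIdx.bnd_N d) (fun _ => rfl)) (Bnd2.comp_tame ht' (TIdx.bnd_N d) (fun _ => rfl)))
    (Bnd2.of_bnd (Bnd.mul (Bnd.const hS 2) (TIdx.bnd_N d)))) (Bnd2.of_bnd (Bnd.const hS 4))

/-- The cost of a bounded quantifier is tame, for a quantifier range `β n ≤ 2^{O(n)}`. [folklore] -/
theorem Tame.bexCost (c : ℕ) {β : ℕ → ℕ} {t : ℕ → ℕ → ℕ} (ht : Tame t)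
    (hβ : ∃ d₀, ∀ n, β n ≤ 2 ^ (d₀ * (n + 1))) : Tame (bexCost c β t) := by
  obtain ⟨d₀, hd₀⟩ := hβ
  refine tame_of_bnd2 fun d => ?_
  have hS := TIdx.one_le d
  have bN := TIdx.bnd_N d
  have bβ : Bnd (fun i : TIdx d => i.1.1 + 1) (fun i => β i.1.1) := ⟨d₀, fun i => hd₀ _⟩
  have bc : ∀ K, Bnd (fun i : TIdx d => i.1.1 + 1) (fun _ => K) := fun K => Bnd.const hS K
  show Bnd2 _ (fun i : TIdx d => 2 ^ (c * (i.1.2 + β i.1.1 + 1)) * (t i.1.1 (2 * i.1.2 + 2 + β i.1.1) + 1))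
  exact Bnd2.mul hS (Bnd2.two_pow (Bnd.mul (bc c) (Bnd.add hS (Bnd.add hS bN bβ) (bc 1))))
    (Bnd2.add hS (Bnd2.comp_tame ht
      (Bnd.add hS (Bnd.add hS (Bnd.mul (bc 2) bN) (bc 2)) bβ) (fun _ => rfl))
      (Bnd2.of_bnd (bc 1)))

/-- **From a tame decider to `DTIME(2^{2^{O(n)}})`.** At the top level (`k = 0`, `n = N`) a tame
bound is `≤ c' · 2^{2^{c n}} + c'`. [folklore] -/
theorem DecIn.mem_DTIME {L : Language Bool} {t : ℕ → ℕ → ℕ} (h : DecIn 0 L t) (ht : Tame t) :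
    ∃ c : ℕ, L ∈ DTIME (fun n => 2 ^ (2 ^ (c * n))) := by
  obtain ⟨a, ha⟩ := ht 1
  obtain ⟨M, hM⟩ := h
  have bound : ∀ N : ℕ, t N N ≤ 2 ^ (2 ^ a) * 2 ^ (2 ^ (2 * a * N)) + 2 ^ (2 ^ a) := by
    intro N
    have h1 := ha N N ((Nat.lt_two_pow_self).le.trans (Nat.pow_le_pow_right (by norm_num) (by omega)))
    have hc : 1 ≤ 2 ^ (2 ^ (2 * a * N)) := Nat.one_le_two_pow
    rcases Nat.eq_zero_or_pos N with h0 | hpos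
    · subst h0
      simp only [zero_add, mul_one] at h1
      nlinarith
    · have h2 : 2 ^ (2 ^ (a * (N + 1))) ≤ 2 ^ (2 ^ (2 * a * N)) :=
        Nat.pow_le_pow_right (by norm_num) (Nat.pow_le_pow_right (by norm_num) (by nlinarith))
      have hc' : 1 ≤ 2 ^ (2 ^ a) := Nat.one_le_two_pow
      nlinarith
  exact ⟨2 * a, 2 ^ (2 ^ a), M, fun u => (hM u).mono (bound u.length)⟩

/-- `DecT k A`: `A` has a tame decider at level `k`. [folklore] -/
def DecT (k : ℕ) (A : Language Bool) : Prop := ∃ t, DecIn k A t ∧ Tame t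

variable {k : ℕ} {A A' : Language Bool}

/-- `P` languages have tame deciders. [folklore] -/
theorem DecT.of_mem_P (hA : A ∈ Classes.P) (k : ℕ) : DecT k A := by
  obtain ⟨c, d, h⟩ := DecIn.of_mem_P hA k
  exact ⟨_, h, Tame.poly c d⟩

/-- Complement. [folklore] -/
theorem DecT.compl (h : DecT k A) : DecT k Aᶜ := by
  obtain ⟨t, h, ht⟩ := h
  exact ⟨t, h.compl, ht⟩

/-- Union. [folklore] -/
theorem DecT.sup (h : DecT k A) (h' : DecT k A') : DecT k (A ⊔ A') := by
  obtain ⟨t, h, ht⟩ := h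
  obtain ⟨t', h', ht'⟩ := h'
  exact ⟨_, h.sup h', ht.supCost ht'⟩

/-- Intersection. [folklore] -/
theorem DecT.inf (h : DecT k A) (h' : DecT k A') : DecT k (A ⊓ A') := by
  obtain ⟨t, h, ht⟩ := h
  obtain ⟨t', h', ht'⟩ := h'
  exact ⟨_, h.inf h', ht.supCost ht'⟩

/-- Bounded existential quantifier. [folklore] -/
theorem DecT.bex {β : ℕ → ℕ} (h : DecT (k + 1) A) (hβ : UnaryProducer β)
    (hβ' : ∃ d₀, ∀ n, β n ≤ 2 ^ (d₀ * (n + 1))) : DecT k (BEX k β A) := by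
  obtain ⟨t, h, ht⟩ := h
  obtain ⟨c, hc⟩ := h.bex hβ
  exact ⟨_, hc, ht.bexCost c hβ'⟩

/-- Bounded universal quantifier. [folklore] -/
theorem DecT.ball {β : ℕ → ℕ} (h : DecT (k + 1) A) (hβ : UnaryProducer β)
    (hβ' : ∃ d₀, ∀ n, β n ≤ 2 ^ (d₀ * (n + 1))) : DecT k (BALL k β A) := by
  obtain ⟨t, h, ht⟩ := h
  obtain ⟨c, hc⟩ := h.ball hβ
  exact ⟨_, hc, ht.bexCost c hβ'⟩

/-- At the top level, a tame decider is a `DTIME(2^{2^{O(n)}})` algorithm. [folklore] -/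
theorem DecT.mem_DTIME {L : Language Bool} (h : DecT 0 L) :
    ∃ c : ℕ, L ∈ DTIME (fun n => 2 ^ (2 ^ (c * n))) := by
  obtain ⟨t, h, ht⟩ := h
  exact h.mem_DTIME ht

/-- The four quantifier ranges are `2^{O(n)}`. [folklore] -/
theorem ranges_le :
    (∀ n, n ≤ 2 ^ (1 * (n + 1))) ∧ (∀ n, 2 ^ n ≤ 2 ^ (1 * (n + 1))) ∧
      (∀ n, wit n ≤ 2 ^ (1 * (n + 1))) ∧ (∀ n, budget n + 1 ≤ 2 ^ (1 * (n + 1))) := by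
  refine ⟨fun n => ?_, fun n => ?_, fun n => ?_, fun n => ?_⟩
  · rw [one_mul]; exact (Nat.lt_two_pow_self).le.trans (Nat.pow_le_pow_right (by norm_num) (by omega))
  · rw [one_mul]; exact Nat.pow_le_pow_right (by norm_num) (by omega)
  · rw [one_mul, wit]; exact Nat.pow_le_pow_right (by norm_num) (by omega)
  · rw [one_mul, budget, pow_succ]
    have : 1 ≤ 2 ^ (n - 1) := Nat.one_le_two_pow
    have : 2 ^ (n - 1) ≤ 2 ^ n := Nat.pow_le_pow_right (by norm_num) (by omega)
    omega

end Tame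

/-! ### The assembly -/

section Assembly

/-- The innermost matrix `L0 ∈ P` has tame deciders at every level. [folklore] -/
theorem L0_decT (k : ℕ) : DecT k L0 := DecT.of_mem_P L0_mem_P k

/-- `NACC k = ∃ v ∈ {0,1}^{wit n} L0`. [folklore] -/
theorem NACC_decT (k : ℕ) : DecT (k + 2) (NACC k) :=
  (L0_decT (k + 3)).bex unaryProducer_wit ⟨1, ranges_le.2.2.1⟩

/-- `NEQV k`, a Boolean combination of `NACC k` and `BIT ∈ P`. [folklore] -/
theorem NEQV_decT (k : ℕ) : DecT (k + 2) (NEQV k) := by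
  unfold NEQV
  exact ((NACC_decT k).inf (DecT.of_mem_P BIT_mem_P _).compl).sup
    ((NACC_decT k).compl.inf (DecT.of_mem_P BIT_mem_P _))

/-- `EXY k = ∃ y ∈ {0,1}^n NEQV k`. [folklore] -/
theorem EXY_decT (k : ℕ) : DecT (k + 1) (EXY k) :=
  (NEQV_decT k).bex unaryProducer_id ⟨1, ranges_le.1⟩

/-- `HARD k = ∀ D' ∈ {0,1}^{budget n + 1} EXY k`. [folklore] -/
theorem HARD_decT (k : ℕ) : DecT k (HARD k) :=
  (EXY_decT k).ball unaryProducer_budget_succ ⟨1, ranges_le.2.2.2⟩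

/-- `MINL = ∀ T' ∈ {0,1}^{2^n} (¬ LT ∨ ¬ HARD 2)`. [folklore] -/
theorem MINL_decT : DecT 1 MINL := by
  unfold MINL
  exact ((DecT.of_mem_P LT_mem_P 2).compl.sup (HARD_decT 2).compl).ball unaryProducer_two_pow
    ⟨1, ranges_le.2.1⟩

/-- `TOP = HARD 1 ∧ MINL ∧ TOPBIT`. [folklore] -/
theorem TOP_decT : DecT 1 TOP := by
  unfold TOP
  exact ((HARD_decT 1).inf MINL_decT).inf (DecT.of_mem_P TOPBIT_mem_P 1)

/-- `nlang = ∃ T ∈ {0,1}^{2^n} TOP` has a tame decider. [folklore] -/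
theorem nlang_decT : DecT 0 nlang := by
  rw [nlang_eq_BEX_TOP]
  exact TOP_decT.bex unaryProducer_two_pow ⟨1, ranges_le.2.1⟩

/-- **Discharge of the named fact `NKannan.nlang_mem_DTIME_exp_exp`**: the least truth table hard
for nondeterministic circuit descriptions is computable in deterministic time `2^{2^{c n}}` for
some `c`, by five nested exhaustive searches over the circuit evaluator (Kannan 1982, proof of
Lemma 3: "a deterministic Turing machine can, given `n`, determine `f` in time at most
`2^{c' n^{3k}}`" — here with the doubly exponential budget appropriate to nondeterministic
descriptions) on Mathlib's multi-stack machines. [cite: Kannan1982, Lemma 3 (proof, p. 46)] -/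
theorem nlang_mem_DTIME_exp_exp_holds : nlang_mem_DTIME_exp_exp :=
  nlang_decT.mem_DTIME

end Assembly

end NKannan

end Literature.Computability.Complexity
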